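import Literature.Analysis.FluidPDE.CKNLocalRegularityRRSPressure
import Literature.Analysis.FluidPDE.CKNEpsilonRegularityForce
import Literature.Analysis.FluidPDE.RusinSverakSingularityStabilityEpsilon
import HarnessLib

/-!
# Lemarié-Rieusset's Theorem 14.4 (ε-regularity criterion), proved

Analysis/FluidPDE glue file **discharging the named fact
`Literature.Analysis.FluidPDE.lemarieRieusset_epsilon_regularity`** (`CKNEpsilonRegularity.lean`;
P. G. Lemarié-Rieusset, *The Navier–Stokes Problem in the 21st Century*, CRC Press 2016,
Thm. 14.4, p. 505: the ε-regularity criterion of Caffarelli–Kohn–Nirenberg for suitable weak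
solutions in the sense of §14.3). The accepted tree reductions are

* `lemarieRieusset_epsilon_regularity_of_theorem15_3_force`
  (`CKNEpsilonRegularityForce`: absorption of the gradient part of the force into the
  pressure, the unit-scale / unit-viscosity normalisations `CKNEpsilonRegularityProofs`,
  `CKNEpsilonRegularityViscosity`, and the glue `CKNLocalRegularityRRSGlueLR` to the first local
  regularity theorem), and
* `RRS2016.theorem15_3_force_holds` (`CKNLocalRegularityRRSPressure`: Robinson–Rodrigo–Sadowski
  2016, Thm. 15.3 with force, fully proved — Steps 1–4, Lemma 15.11, Lemma 15.12).

Hence `lemarieRieusset_epsilon_regularity_holds`, `lemarieRieusset_epsilon_regularity_nu_one_holds`,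
and, by the accepted reductions of their files, the discharges
`rusin_sverak_stability_of_singularities_holds` (Rusin–Šverák 2011, Lemma 2.1;
`rusin_sverak_stability_of_singularities_of_theorem15_3`) and
`lemarieRieusset_epsilon_regularity_divFree_holds` (Thm. 14.4 for solenoidal forces).

## References

* P. G. Lemarié-Rieusset, *The Navier–Stokes Problem in the 21st Century*, CRC Press (2016),
  Thm. 14.4, p. 505. [LemarieRieusset2016]
* L. Caffarelli, R. Kohn, L. Nirenberg, *Partial regularity of suitable weak solutions of the
  Navier–Stokes equations*, Comm. Pure Appl. Math. 35 (1982), Propositions 1–2, §1.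
* J. C. Robinson, J. L. Rodrigo, W. Sadowski, *The Three-Dimensional Navier–Stokes Equations*,
  CUP (2016), Thm. 15.3, Lemma 15.12.
* W. Rusin, V. Šverák, *Minimal initial data for potential Navier–Stokes singularities*,
  J. Funct. Anal. 260 (2011), Lemma 2.1.
-/

noncomputable section

namespace Literature.Analysis.FluidPDE

/-- **Lemarié-Rieusset 2016, Theorem 14.4 (the ε-regularity criterion), proved.** [cite: LemarieRieusset2016, Thm. 14.4 p. 505] -/
theorem lemarieRieusset_epsilon_regularity_holds : lemarieRieusset_epsilon_regularity :=
  lemarieRieusset_epsilon_regularity_of_theorem15_3_force RRS2016.theorem15_3_force_holds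

/-- **Theorem 14.4 at `ν = 1`, `r₀ = 1`, proved** (the named statement
`lemarieRieusset_epsilon_regularity_nu_one`). [cite: LemarieRieusset2016, Thm. 14.4 p. 505] -/
theorem lemarieRieusset_epsilon_regularity_nu_one_holds : lemarieRieusset_epsilon_regularity_nu_one :=
  lemarieRieusset_epsilon_regularity_nu_one_of_theorem15_3_force RRS2016.theorem15_3_force_holds

/-- **Theorem 14.4 for solenoidal forces, proved** (the named statement
`lemarieRieusset_epsilon_regularity_divFree`). [cite: LemarieRieusset2016, Thm. 14.4 p. 505, solenoidal force] -/
theorem lemarieRieusset_epsilon_regularity_divFree_holds : lemarieRieusset_epsilon_regularity_divFree :=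
  lemarieRieusset_epsilon_regularity_divFree_of_lemma15_12 RRS2016.lemma15_12_holds

/-- **Rusin–Šverák 2011, Lemma 2.1 (stability of singularities), proved** (the named fact
`rusin_sverak_stability_of_singularities`). [cite: RusinSverak2011, Lemma 2.1] -/
theorem rusin_sverak_stability_of_singularities_holds : rusin_sverak_stability_of_singularities :=
  rusin_sverak_stability_of_singularities_of_theorem15_3 RRS2016.theorem15_3_holds

end Literature.Analysis.FluidPDE
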